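import Mathlib.Analysis.Fourier.Inversion
import Mathlib.Analysis.SpecialFunctions.JapaneseBracket
import Literature.NumberTheory.Sieve.SmoothIdealCosetSums
import HarnessLib

/-!
# Separation of variables in smooth product weights by Fourier inversion

Topic `Literature/NumberTheory/Sieve`, sub-namespace `LogSep`. In the type II sums of the
Bombieri–Vinogradov theorem over a totally real field (Hinz 1988, §3–§4) the two variables
`α₁, α₂` are tied together by the condition that `α₁α₂/ρ₀` lies in the box. Hinz removes this
"hyperbolic" condition with a discrete logarithmic Fourier analysis ((3.6)–(3.12)); with a SMOOTH
product weight `∏_w h_w(log σ_w α₁ + log σ_w α₂ - s_w)` the separation is the Fourier inversion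
formula: `h_w(v) = ∫ ĥ_w(τ) e(τ v) dτ`, so the weight is an absolutely convergent average of
products of unimodular functions of `α₁` and of `α₂`, and any bound for twisted bilinear forms
that is uniform in unimodular twists transfers at the cost of the factor `∏_w ‖ĥ_w‖₁`.
Everything is PROVED:

* `integrable_dec_two`, `decInt` — `min(1, |τ|^{-2})` is integrable (`decInt = ∫ min(1,|τ|^{-2})`);
* `integrable_fourier`, `integral_norm_fourier_le` — for `h ∈ C²_c(ℝ)`: `ĥ ∈ L¹` with
  `‖ĥ‖₁ ≤ decInt · max(‖h‖₁, ‖h''‖₁/(2π)²)` (`SmoothCoset.norm_fourier_le_dec`);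
* `eq_integral_fourier` — Fourier inversion `h(v) = ∫ ĥ(τ) e(τv) dτ` (Mathlib
  `Continuous.fourierInv_fourier_eq`);
* `prod_eq_integral` — the product formula
  `∏_i h_i(v_i) = ∫_{ℝ^ι} (∏_i ĥ_i(τ_i) e(τ_i v_i)) dτ`;
* `weightedNormSum_le_integral`, `weightedNormSum_le` — **the separation inequality**: if
  `F(α₁,α₂) = ∫ K(τ) F_τ(α₁,α₂) dτ` with `K ∈ L¹` and `F_τ` bounded and continuous in `τ`, then for
  every finite family of functionals `Φ(F) = ∑_j w_j |∑_{α₁,α₂} F(α₁,α₂) u_j(α₁,α₂)|` (`w_j ≥ 0`) one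
  has `Φ(F) ≤ ∫ |K(τ)| Φ(F_τ) dτ ≤ ‖K‖₁ sup_τ Φ(F_τ)`.

## References

* J. Hinz, *A generalization of Bombieri's prime number theorem to algebraic number fields*,
  Acta Arith. 51 (1988), §3, (3.6)–(3.12) (removal of the hyperbolic condition).
  [cite: Hinz1988, §3 (3.6)–(3.12)]
-/

noncomputable section

open MeasureTheory Real Finset Literature.NumberTheory.Sieve.SmoothCoset
open scoped FourierTransform

namespace Literature.NumberTheory.Sieve.LogSep

/-! ## One-dimensional facts: `ĥ ∈ L¹` for `h ∈ C²_c` and Fourier inversion -/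

/-- `min(1,|τ|^{-2}) ≤ 4 (1 + |τ|)^{-2}`. [folklore] -/
theorem dec_two_le (τ : ℝ) : dec 2 τ ≤ 4 * (1 + ‖τ‖) ^ (-(2 : ℝ)) := by
  rw [Real.norm_eq_abs, dec, Real.rpow_neg (by positivity), show (2 : ℝ) = (2 : ℕ) by norm_num,
    Real.rpow_natCast]
  have h1 : (1 + |τ|) ≤ 2 * max 1 |τ| := by
    have := le_max_left (1 : ℝ) |τ|; have := le_max_right (1 : ℝ) |τ|; linarith
  have h0 : 0 < max 1 |τ| := lt_of_lt_of_le one_pos (le_max_left _ _)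
  have h2 : (1 + |τ|) ^ 2 ≤ 4 * (max 1 |τ|) ^ 2 := by nlinarith [abs_nonneg τ]
  rw [← div_eq_mul_inv, le_div_iff₀ (by positivity)]
  calc ((max 1 |τ|) ^ 2)⁻¹ * (1 + |τ|) ^ 2 ≤ ((max 1 |τ|) ^ 2)⁻¹ * (4 * (max 1 |τ|) ^ 2) := by
        gcongr
    _ = 4 := by field_simp

/-- `min(1,|τ|^{-2})` is integrable on `ℝ`. [folklore] -/
theorem integrable_dec_two : Integrable (dec 2) := by
  have h := (integrable_one_add_norm (E := ℝ) (μ := volume) (r := 2) (by rw [Module.finrank_self]; norm_num)).const_mul 4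
  refine h.mono' ?_ (ae_of_all _ fun τ => ?_)
  · refine Measurable.aestronglyMeasurable ?_
    unfold dec
    exact ((measurable_const.max measurable_norm).pow_const _).inv
  · rw [Real.norm_eq_abs, abs_of_nonneg (dec_nonneg _ _)]
    exact dec_two_le τ

/-- The absolute constant `∫ min(1,|τ|^{-2}) dτ` (`= 4`). [folklore] -/
def decInt : ℝ := ∫ τ, dec 2 τ

/-- `decInt ≥ 0`. [folklore] -/
theorem decInt_nonneg : 0 ≤ decInt := integral_nonneg fun _ => dec_nonneg _ _

variable {h : ℝ → ℂ}

/-- The Fourier transform of an integrable function is continuous. [folklore] -/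
theorem continuous_fourier (hi : Integrable h) : Continuous (𝓕 h) :=
  VectorFourier.fourierIntegral_continuous Real.continuous_fourierChar (innerSL ℝ).continuous₂ hi

/-- **`ĥ ∈ L¹` for `h ∈ C²_c(ℝ)`**, with `‖ĥ‖₁ ≤ decInt · max(‖h‖₁, ‖h''‖₁/(2π)²)`. [folklore] -/
theorem integrable_fourier (hh : ContDiff ℝ 2 h) (hs : HasCompactSupport h) : Integrable (𝓕 h) := by
  have hi : Integrable h := hh.continuous.integrable_of_hasCompactSupport hs
  refine (integrable_dec_two.const_mul (max (∫ x, ‖h x‖) ((∫ x, ‖iteratedDeriv 2 h x‖) / (2 * π) ^ 2))).mono'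
    (continuous_fourier hi).aestronglyMeasurable (ae_of_all _ fun τ => ?_)
  exact norm_fourier_le_dec hh hs _

/-- `‖ĥ‖₁ ≤ decInt · max(‖h‖₁, ‖h''‖₁/(2π)²)` for `h ∈ C²_c(ℝ)`. [folklore] -/
theorem integral_norm_fourier_le (hh : ContDiff ℝ 2 h) (hs : HasCompactSupport h) :
    ∫ τ, ‖𝓕 h τ‖ ≤ decInt * max (∫ x, ‖h x‖) ((∫ x, ‖iteratedDeriv 2 h x‖) / (2 * π) ^ 2) := by
  rw [decInt, ← integral_mul_const]
  refine integral_mono (integrable_fourier hh hs).norm (integrable_dec_two.mul_const _) fun τ => ?_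
  rw [mul_comm]
  exact norm_fourier_le_dec hh hs τ

/-- **Fourier inversion for `C²_c` functions**: `h(v) = ∫ ĥ(τ) e(τ v) dτ`. [folklore] -/
theorem eq_integral_fourier (hh : ContDiff ℝ 2 h) (hs : HasCompactSupport h) (v : ℝ) :
    h v = ∫ τ, ((𝐞 (τ * v) : Circle) : ℂ) * 𝓕 h τ := by
  have hi : Integrable h := hh.continuous.integrable_of_hasCompactSupport hs
  have hinv := hh.continuous.fourierInv_fourier_eq hi (integrable_fourier hh hs)
  conv_lhs => rw [← hinv]
  rw [Real.fourierInv_eq]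
  refine integral_congr_ae (ae_of_all _ fun τ => ?_)
  simp only [RCLike.inner_apply, conj_trivial, Circle.smul_def, smul_eq_mul, mul_comm v τ]

/-! ## The product formula -/

section Product

variable {ι : Type*} [Fintype ι]

/-- **Separation of a product weight**:
`∏_i h_i(v_i) = ∫_{ℝ^ι} ∏_i (e(τ_i v_i) ĥ_i(τ_i)) dτ` for `h_i ∈ C²_c(ℝ)`. [folklore] -/
theorem prod_eq_integral {h : ι → ℝ → ℂ} (hh : ∀ i, ContDiff ℝ 2 (h i))
    (hs : ∀ i, HasCompactSupport (h i)) (v : ι → ℝ) :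
    ∏ i, h i (v i) = ∫ τ : ι → ℝ, ∏ i, ((𝐞 (τ i * v i) : Circle) : ℂ) * 𝓕 (h i) (τ i) := by
  rw [integral_fintype_prod_volume_eq_prod (𝕜 := ℂ)
    (f := fun i (τ : ℝ) => ((𝐞 (τ * v i) : Circle) : ℂ) * 𝓕 (h i) τ)]
  exact Finset.prod_congr rfl fun i _ => eq_integral_fourier (hh i) (hs i) (v i)

/-- The separating kernel is integrable on `ℝ^ι`, with `L¹` norm the product of the `‖ĥ_i‖₁`.
[folklore] -/
theorem integrable_prod_fourier {h : ι → ℝ → ℂ} (hh : ∀ i, ContDiff ℝ 2 (h i))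
    (hs : ∀ i, HasCompactSupport (h i)) (c : ι → ℝ) :
    Integrable fun τ : ι → ℝ => ∏ i, ((𝐞 (τ i * c i) : Circle) : ℂ) * 𝓕 (h i) (τ i) := by
  have := Integrable.fintype_prod (ι := ι) (μ := fun _ => (volume : Measure ℝ))
    (f := fun i (τ : ℝ) => ((𝐞 (τ * c i) : Circle) : ℂ) * 𝓕 (h i) τ) fun i => ?_
  · exact this
  · refine (integrable_fourier (hh i) (hs i)).bdd_mul (c := 1) ?_ (ae_of_all _ fun τ => ?_)
    · exact (Continuous.comp continuous_subtype_val
        (Real.continuous_fourierChar.comp (continuous_id.mul continuous_const))).aestronglyMeasurable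
    · rw [Circle.norm_coe]

/-- `∫ |∏_i e(τ_i c_i) ĥ_i(τ_i)| dτ = ∏_i ‖ĥ_i‖₁`. [folklore] -/
theorem integral_norm_prod_fourier_eq {h : ι → ℝ → ℂ} (c : ι → ℝ) :
    ∫ τ : ι → ℝ, ‖∏ i, ((𝐞 (τ i * c i) : Circle) : ℂ) * 𝓕 (h i) (τ i)‖ = ∏ i, ∫ τ, ‖𝓕 (h i) τ‖ := by
  have h1 : ∀ τ : ι → ℝ, ‖∏ i, ((𝐞 (τ i * c i) : Circle) : ℂ) * 𝓕 (h i) (τ i)‖ =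
      ∏ i, ‖𝓕 (h i) (τ i)‖ := fun τ => by
    rw [norm_prod]
    exact Finset.prod_congr rfl fun i _ => by rw [norm_mul, Circle.norm_coe, one_mul]
  simp_rw [h1]
  have := integral_fintype_prod_volume_eq_prod (𝕜 := ℝ) (f := fun i (τ : ℝ) => ‖𝓕 (h i) τ‖)
  exact this

end Product

/-! ## The separation inequality -/

section Separation

variable {X T J : Type*} [MeasurableSpace T] {μ : Measure T}

/-- A weighted sum of norms of bilinear-form values:
`Φ(F) = ∑_{j ∈ Js} w_j |∑_{α₁ ∈ A₁} ∑_{α₂ ∈ A₂} F(α₁,α₂) u_j(α₁,α₂)|`. [folklore] -/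
def weightedNormSum (Js : Finset J) (w : J → ℝ) (u : J → X → X → ℂ) (A₁ A₂ : Finset X)
    (F : X → X → ℂ) : ℝ :=
  ∑ j ∈ Js, w j * ‖∑ α₁ ∈ A₁, ∑ α₂ ∈ A₂, F α₁ α₂ * u j α₁ α₂‖

/-- A pointwise bound: if `|F| ≤ M` on `A₁ × A₂` then `Φ(F) ≤ ∑_j w_j ∑∑ M |u_j|`. [folklore] -/
theorem weightedNormSum_le_of_bound {Js : Finset J} {w : J → ℝ} (hw : ∀ j ∈ Js, 0 ≤ w j)
    {u : J → X → X → ℂ} {A₁ A₂ : Finset X} {F : X → X → ℂ} {M : ℝ}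
    (hF : ∀ α₁ ∈ A₁, ∀ α₂ ∈ A₂, ‖F α₁ α₂‖ ≤ M) :
    weightedNormSum Js w u A₁ A₂ F ≤ ∑ j ∈ Js, w j * ∑ α₁ ∈ A₁, ∑ α₂ ∈ A₂, M * ‖u j α₁ α₂‖ := by
  refine Finset.sum_le_sum fun j hj => mul_le_mul_of_nonneg_left ?_ (hw j hj)
  refine (norm_sum_le _ _).trans (Finset.sum_le_sum fun α₁ h₁ => ?_)
  refine (norm_sum_le _ _).trans (Finset.sum_le_sum fun α₂ h₂ => ?_)
  rw [norm_mul]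
  exact mul_le_mul_of_nonneg_right (hF α₁ h₁ α₂ h₂) (norm_nonneg _)

/-- **The separation inequality, integral form.** If `F(α₁,α₂) = ∫ K(τ) F_τ(α₁,α₂) dμ(τ)` for
`(α₁,α₂) ∈ A₁ × A₂`, with `K ∈ L¹(μ)`, `τ ↦ F_τ(α₁,α₂)` strongly measurable and `|F_τ| ≤ M`, then
`Φ(F) ≤ ∫ |K(τ)| Φ(F_τ) dμ(τ)` for every weighted norm sum `Φ` with nonnegative weights.
[cite: Hinz1988, §3 (3.6)–(3.12)] -/
theorem weightedNormSum_le_integral {Js : Finset J} {w : J → ℝ} (hw : ∀ j ∈ Js, 0 ≤ w j)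
    (u : J → X → X → ℂ) {A₁ A₂ : Finset X} {K : T → ℂ} (hK : Integrable K μ)
    {Fτ : T → X → X → ℂ} (hFm : ∀ α₁ ∈ A₁, ∀ α₂ ∈ A₂, AEStronglyMeasurable (fun τ => Fτ τ α₁ α₂) μ)
    {M : ℝ} (hFM : ∀ τ, ∀ α₁ ∈ A₁, ∀ α₂ ∈ A₂, ‖Fτ τ α₁ α₂‖ ≤ M)
    {F : X → X → ℂ} (hF : ∀ α₁ ∈ A₁, ∀ α₂ ∈ A₂, F α₁ α₂ = ∫ τ, K τ * Fτ τ α₁ α₂ ∂μ) :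
    weightedNormSum Js w u A₁ A₂ F ≤ ∫ τ, ‖K τ‖ * weightedNormSum Js w u A₁ A₂ (Fτ τ) ∂μ := by
  -- the bilinear sums
  set S : J → (X → X → ℂ) → ℂ := fun j G => ∑ α₁ ∈ A₁, ∑ α₂ ∈ A₂, G α₁ α₂ * u j α₁ α₂ with hS
  -- measurability and boundedness of `τ ↦ S_j(F_τ)`
  have hSm : ∀ j, AEStronglyMeasurable (fun τ => S j (Fτ τ)) μ := by
    intro j
    simp only [hS]
    refine Finset.aestronglyMeasurable_fun_sum A₁
      (f := fun α₁ τ => ∑ α₂ ∈ A₂, Fτ τ α₁ α₂ * u j α₁ α₂) fun α₁ h₁ => ?_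
    exact Finset.aestronglyMeasurable_fun_sum A₂ (f := fun α₂ τ => Fτ τ α₁ α₂ * u j α₁ α₂)
      fun α₂ h₂ => (hFm α₁ h₁ α₂ h₂).mul_const _
  have hSb : ∀ j τ, ‖S j (Fτ τ)‖ ≤ ∑ α₁ ∈ A₁, ∑ α₂ ∈ A₂, M * ‖u j α₁ α₂‖ := by
    intro j τ
    simp only [hS]
    refine (norm_sum_le _ _).trans (Finset.sum_le_sum fun α₁ h₁ => ?_)
    refine (norm_sum_le _ _).trans (Finset.sum_le_sum fun α₂ h₂ => ?_)
    rw [norm_mul]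
    exact mul_le_mul_of_nonneg_right (hFM τ α₁ h₁ α₂ h₂) (norm_nonneg _)
  -- Step 1: `S_j(F) = ∫ K S_j(F_τ)`
  have hint : ∀ j, ∀ α₁ ∈ A₁, ∀ α₂ ∈ A₂,
      Integrable (fun τ => K τ * (Fτ τ α₁ α₂ * u j α₁ α₂)) μ := by
    intro j α₁ h₁ α₂ h₂
    have h := hK.bdd_mul (c := M * ‖u j α₁ α₂‖) ((hFm α₁ h₁ α₂ h₂).mul_const (u j α₁ α₂))
      (ae_of_all _ fun τ => by
        rw [norm_mul]; exact mul_le_mul_of_nonneg_right (hFM τ α₁ h₁ α₂ h₂) (norm_nonneg _))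
    refine h.congr (ae_of_all _ fun τ => ?_)
    ring
  have h1 : ∀ j, S j F = ∫ τ, K τ * S j (Fτ τ) ∂μ := by
    intro j
    simp only [hS]
    rw [← integral_congr_ae (ae_of_all _ fun τ => (Finset.mul_sum A₁ _ (K τ)).symm)]
    · rw [integral_finsetSum _ fun α₁ h₁ => ?_]
      · refine Finset.sum_congr rfl fun α₁ h₁ => ?_
        rw [← integral_congr_ae (ae_of_all _ fun τ => (Finset.mul_sum A₂ _ (K τ)).symm)]
        · rw [integral_finsetSum _ fun α₂ h₂ => hint j α₁ h₁ α₂ h₂]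
          refine Finset.sum_congr rfl fun α₂ h₂ => ?_
          rw [hF α₁ h₁ α₂ h₂, ← integral_mul_const]
          refine integral_congr_ae (ae_of_all _ fun τ => ?_)
          simp only; ring
      · refine (integrable_finsetSum _ fun α₂ h₂ => hint j α₁ h₁ α₂ h₂).congr
          (ae_of_all _ fun τ => ?_)
        simp only [Finset.mul_sum]
  -- Step 2/3: sum the norm inequalities
  have hint2 : ∀ j, Integrable (fun τ => ‖K τ‖ * ‖S j (Fτ τ)‖) μ := by
    intro j
    have h := hK.norm.bdd_mul (c := ∑ α₁ ∈ A₁, ∑ α₂ ∈ A₂, M * ‖u j α₁ α₂‖) (hSm j).norm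
      (ae_of_all _ fun τ => by rw [norm_norm]; exact hSb j τ)
    refine h.congr (ae_of_all _ fun τ => ?_)
    ring
  calc weightedNormSum Js w u A₁ A₂ F = ∑ j ∈ Js, w j * ‖S j F‖ := rfl
    _ ≤ ∑ j ∈ Js, w j * ∫ τ, ‖K τ‖ * ‖S j (Fτ τ)‖ ∂μ := by
        refine Finset.sum_le_sum fun j hj => mul_le_mul_of_nonneg_left ?_ (hw j hj)
        rw [h1 j]
        refine (norm_integral_le_integral_norm _).trans (le_of_eq ?_)
        refine integral_congr_ae (ae_of_all _ fun τ => ?_)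
        simp only [norm_mul]
    _ = ∫ τ, ∑ j ∈ Js, w j * (‖K τ‖ * ‖S j (Fτ τ)‖) ∂μ := by
        rw [integral_finsetSum _ fun j _ => (hint2 j).const_mul (w j)]
        refine Finset.sum_congr rfl fun j _ => ?_
        rw [integral_const_mul]
    _ = ∫ τ, ‖K τ‖ * weightedNormSum Js w u A₁ A₂ (Fτ τ) ∂μ := by
        refine integral_congr_ae (ae_of_all _ fun τ => ?_)
        simp only [weightedNormSum, hS, Finset.mul_sum]
        refine Finset.sum_congr rfl fun j _ => ?_
        ring

/-- **The separation inequality**: under the hypotheses of `weightedNormSum_le_integral`, if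
`Φ(F_τ) ≤ B` for all `τ` then `Φ(F) ≤ B ∫ |K| dμ`. [cite: Hinz1988, §3 (3.6)–(3.12)] -/
theorem weightedNormSum_le {Js : Finset J} {w : J → ℝ} (hw : ∀ j ∈ Js, 0 ≤ w j)
    (u : J → X → X → ℂ) {A₁ A₂ : Finset X} {K : T → ℂ} (hK : Integrable K μ)
    {Fτ : T → X → X → ℂ} (hFm : ∀ α₁ ∈ A₁, ∀ α₂ ∈ A₂, AEStronglyMeasurable (fun τ => Fτ τ α₁ α₂) μ)
    {M : ℝ} (hFM : ∀ τ, ∀ α₁ ∈ A₁, ∀ α₂ ∈ A₂, ‖Fτ τ α₁ α₂‖ ≤ M)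
    {F : X → X → ℂ} (hF : ∀ α₁ ∈ A₁, ∀ α₂ ∈ A₂, F α₁ α₂ = ∫ τ, K τ * Fτ τ α₁ α₂ ∂μ)
    {B : ℝ} (hB : ∀ τ, weightedNormSum Js w u A₁ A₂ (Fτ τ) ≤ B) :
    weightedNormSum Js w u A₁ A₂ F ≤ B * ∫ τ, ‖K τ‖ ∂μ := by
  refine (weightedNormSum_le_integral hw u hK hFm hFM hF).trans ?_
  rw [← integral_const_mul]
  refine integral_mono_of_nonneg (ae_of_all _ fun τ => ?_) (hK.norm.const_mul B) (ae_of_all _ fun τ => ?_)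
  · exact mul_nonneg (norm_nonneg _) (Finset.sum_nonneg fun j hj => mul_nonneg (hw j hj) (norm_nonneg _))
  · simp only
    rw [mul_comm B]
    exact mul_le_mul_of_nonneg_left (hB τ) (norm_nonneg _)

end Separation


/-! ## The separation inequality for smooth product weights -/

section ProductWeight

variable {ι X J : Type*} [Fintype ι]

/-- The smooth cross weight `H(α₁,α₂) = ∏_i h_i(ℓ₁(α₁)_i + ℓ₂(α₂)_i - s_i)`. [folklore] -/
def crossWeight (h : ι → ℝ → ℂ) (ℓ₁ ℓ₂ : X → ι → ℝ) (s : ι → ℝ) (α₁ α₂ : X) : ℂ :=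
  ∏ i, h i (ℓ₁ α₁ i + ℓ₂ α₂ i - s i)

/-- The unimodular twist `θ^τ(α) = ∏_i e(τ_i ℓ(α)_i)`. [folklore] -/
def twist (ℓ : X → ι → ℝ) (τ : ι → ℝ) (α : X) : ℂ := ∏ i, ((𝐞 (τ i * ℓ α i) : Circle) : ℂ)

omit [Fintype ι] in
/-- Twists are unimodular. [folklore] -/
theorem norm_twist [Fintype ι] (ℓ : X → ι → ℝ) (τ : ι → ℝ) (α : X) : ‖twist ℓ τ α‖ = 1 := by
  rw [twist, norm_prod]
  exact Finset.prod_eq_one fun i _ => Circle.norm_coe _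

/-- Twists depend continuously on the frequency. [folklore] -/
theorem continuous_twist (ℓ : X → ι → ℝ) (α : X) : Continuous fun τ : ι → ℝ => twist ℓ τ α :=
  continuous_finsetProd _ fun i _ => continuous_subtype_val.comp
    (Real.continuous_fourierChar.comp ((continuous_apply i).mul continuous_const))

/-- **Separation of variables for smooth product cross weights.** Let `h_i ∈ C²_c(ℝ)` and let
`Φ(F) = ∑_{j} w_j |∑_{α₁∈A₁}∑_{α₂∈A₂} F(α₁,α₂) u_j(α₁,α₂)|` (`w_j ≥ 0`). If
`Φ((α₁,α₂) ↦ c₁(α₁)θ₁(α₁) · c₂(α₂)θ₂(α₂)) ≤ B` for all unimodular `θ₁, θ₂ : X → ℂ`, then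

  `Φ((α₁,α₂) ↦ c₁(α₁) c₂(α₂) ∏_i h_i(ℓ₁(α₁)_i + ℓ₂(α₂)_i - s_i)) ≤ B ∏_i ‖ĥ_i‖₁`.

(Fourier inversion in each coordinate; the smooth replacement of Hinz's (3.6)–(3.12).)
[cite: Hinz1988, §3 (3.12)] -/
theorem weightedNormSum_crossWeight_le {h : ι → ℝ → ℂ} (hh : ∀ i, ContDiff ℝ 2 (h i))
    (hs : ∀ i, HasCompactSupport (h i)) (ℓ₁ ℓ₂ : X → ι → ℝ) (s : ι → ℝ)
    {Js : Finset J} {w : J → ℝ} (hw : ∀ j ∈ Js, 0 ≤ w j) (u : J → X → X → ℂ)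
    (A₁ A₂ : Finset X) (c₁ c₂ : X → ℂ) {B : ℝ}
    (hB : ∀ θ₁ θ₂ : X → ℂ, (∀ α, ‖θ₁ α‖ = 1) → (∀ α, ‖θ₂ α‖ = 1) →
      weightedNormSum Js w u A₁ A₂ (fun α₁ α₂ => (c₁ α₁ * θ₁ α₁) * (c₂ α₂ * θ₂ α₂)) ≤ B) :
    weightedNormSum Js w u A₁ A₂ (fun α₁ α₂ => c₁ α₁ * c₂ α₂ * crossWeight h ℓ₁ ℓ₂ s α₁ α₂) ≤
      B * ∏ i, ∫ τ, ‖𝓕 (h i) τ‖ := by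
  classical
  -- kernel and twisted coefficients
  set K : (ι → ℝ) → ℂ := fun τ => ∏ i, ((𝐞 (τ i * -s i) : Circle) : ℂ) * 𝓕 (h i) (τ i) with hK
  set Fτ : (ι → ℝ) → X → X → ℂ := fun τ α₁ α₂ =>
    (c₁ α₁ * twist ℓ₁ τ α₁) * (c₂ α₂ * twist ℓ₂ τ α₂) with hFτ
  -- a bound for the coefficients on `A₁ × A₂`
  set M : ℝ := (∑ α₁ ∈ A₁, ‖c₁ α₁‖) * ∑ α₂ ∈ A₂, ‖c₂ α₂‖ with hM
  have hFM : ∀ τ, ∀ α₁ ∈ A₁, ∀ α₂ ∈ A₂, ‖Fτ τ α₁ α₂‖ ≤ M := by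
    intro τ α₁ h₁ α₂ h₂
    simp only [hFτ, norm_mul, norm_twist, mul_one, hM]
    exact mul_le_mul (Finset.single_le_sum (fun _ _ => norm_nonneg _) h₁)
      (Finset.single_le_sum (fun _ _ => norm_nonneg _) h₂) (norm_nonneg _)
      (Finset.sum_nonneg fun _ _ => norm_nonneg _)
  have hFm : ∀ α₁ ∈ A₁, ∀ α₂ ∈ A₂, AEStronglyMeasurable (fun τ => Fτ τ α₁ α₂) volume := by
    intro α₁ _ α₂ _
    exact ((continuous_const.mul (continuous_twist ℓ₁ α₁)).mul
      (continuous_const.mul (continuous_twist ℓ₂ α₂))).aestronglyMeasurable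
  -- the Fourier representation of the cross weight
  have hF : ∀ α₁ ∈ A₁, ∀ α₂ ∈ A₂,
      c₁ α₁ * c₂ α₂ * crossWeight h ℓ₁ ℓ₂ s α₁ α₂ = ∫ τ, K τ * Fτ τ α₁ α₂ := by
    intro α₁ _ α₂ _
    rw [crossWeight, prod_eq_integral hh hs, ← integral_const_mul]
    refine integral_congr_ae (ae_of_all _ fun τ => ?_)
    have hterm : ∀ i, ((𝐞 (τ i * -s i) : Circle) : ℂ) * 𝓕 (h i) (τ i) *
        ((𝐞 (τ i * ℓ₁ α₁ i) : Circle) : ℂ) * ((𝐞 (τ i * ℓ₂ α₂ i) : Circle) : ℂ) =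
        ((𝐞 (τ i * (ℓ₁ α₁ i + ℓ₂ α₂ i - s i)) : Circle) : ℂ) * 𝓕 (h i) (τ i) := by
      intro i
      rw [show τ i * (ℓ₁ α₁ i + ℓ₂ α₂ i - s i) = τ i * -s i + τ i * ℓ₁ α₁ i + τ i * ℓ₂ α₂ i by ring,
        AddChar.map_add_eq_mul, AddChar.map_add_eq_mul, Circle.coe_mul, Circle.coe_mul]
      ring
    simp only
    calc c₁ α₁ * c₂ α₂ * ∏ i, ((𝐞 (τ i * (ℓ₁ α₁ i + ℓ₂ α₂ i - s i)) : Circle) : ℂ) * 𝓕 (h i) (τ i)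
        = c₁ α₁ * c₂ α₂ * ∏ i, (((𝐞 (τ i * -s i) : Circle) : ℂ) * 𝓕 (h i) (τ i) *
            ((𝐞 (τ i * ℓ₁ α₁ i) : Circle) : ℂ) * ((𝐞 (τ i * ℓ₂ α₂ i) : Circle) : ℂ)) := by
          rw [Finset.prod_congr rfl fun i _ => (hterm i).symm]
      _ = (∏ i, ((𝐞 (τ i * -s i) : Circle) : ℂ) * 𝓕 (h i) (τ i)) *
            ((c₁ α₁ * ∏ i, ((𝐞 (τ i * ℓ₁ α₁ i) : Circle) : ℂ)) *
              (c₂ α₂ * ∏ i, ((𝐞 (τ i * ℓ₂ α₂ i) : Circle) : ℂ))) := by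
          rw [Finset.prod_mul_distrib, Finset.prod_mul_distrib]; ring
      _ = K τ * Fτ τ α₁ α₂ := by simp only [hK, hFτ, twist]
  -- kernel integrability and `L¹` norm
  have hKi : Integrable K := integrable_prod_fourier hh hs fun i => -s i
  have hKn : ∫ τ, ‖K τ‖ = ∏ i, ∫ τ, ‖𝓕 (h i) τ‖ := integral_norm_prod_fourier_eq fun i => -s i
  -- the abstract separation inequality
  have hB' : ∀ τ, weightedNormSum Js w u A₁ A₂ (Fτ τ) ≤ B := fun τ =>
    hB (twist ℓ₁ τ) (twist ℓ₂ τ) (norm_twist ℓ₁ τ) (norm_twist ℓ₂ τ)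
  have h := weightedNormSum_le (μ := volume) hw u hKi hFm hFM hF hB'
  rw [hKn] at h
  exact h

end ProductWeight

end Literature.NumberTheory.Sieve.LogSep
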